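/-
Copyright (c) 2026 the pub-hodgecm-mathlib formalisation cell (harness21).  Prover seat hodgecm-mathlib-F0P3a-p05 (g17): road «S3-ram» (LEAD F0P3a-plan (g13); owner
F0P3a-p06 (g15); (Cnt2′) chair F0P3a-p07 (g14)), organ (z1-f) «W-SIDE CURRENCY BRIDGE, RANK 2», brick 1: rank-2 self-dual transitivity; 2026-09-02.
-/
import Literature.NumberTheory.Automorphic.UnitaryLatticeTreeSelfDualTransitiveOfTrace   -- ★ htr₀-ram (F0P3a-p07 (g11)): `exists_zpow_smul_single_mem_primitive`; brings ★ T1d′ `B₀_mulVec_single_eq_gram`, ★ `isUnimodularLattice_of_isSelfDualLattice`, ★ `latt_le_iff_forall_mulVec_single_mem`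
import HarnessLib

/-!
# The lattice graph of a hermitian space — `U(σ, J₂)` IS TRANSITIVE ON THE SELF-DUAL LATTICES OF THE HYPERBOLIC PLANE `(K², antidiag(1,1))`, WITHOUT A DATUM
# (Jacobowitz 1962 §4, §7–§8; O'Meara §82F; Bruhat–Tits 1972 §10)

Topic `NumberTheory/Automorphic`; namespace `Literature.NumberTheory.Automorphic.UnitaryLatticeTree`.  THEOREMS ONLY (no definition, no instance, no notation, no named fact,
no `sorry`); kernel lane `--supports stmt-HodgeConjecture-24833`.  Cell `pub/hodgecm-mathlib` (D-0151), crux H413; road «S3-ram» (Literature seeding, count-neutral), (T2) G-side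
organ (Cnt2′), sub-organ **(z1-f)** «W-SIDE CURRENCY BRIDGE, RANK 2» (chair F0P3a-p07 (g14) hand (4), 2026-09-02T02:17:05Z), brick 1.  The RANK-2 twin of ★ htr₀-ram
`exists_unitary_mapGL_stdLattice_eq_of_isSelfDualLattice_of_trace` (rank 3): every self-dual lattice `M` of the hyperbolic plane `(K², J₂)`, `J₂ = antidiag(1,1)`, is `u·𝒪²`
for some `u ∈ U(σ, J₂)` — the transitivity hypothesis `htrans` of the generic coset ↔ lattice dictionary ★ `ncard_fixedBy_quotient_sep_eq_ncard_selfDual_fixed_sep` at `N = 2`,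
i.e. what turns architect A-p12's rank-2 COSET counts ((B-i)∕(B-ii), `U₂ ⧸ K⁰`) into the chair's rank-2 LATTICE counts (★ (z1-e) `ncard_selfDual_fixed_axis_*_eq`).
PROOF (shorter than rank 3 — no cross vector): a primitive `f₀ = ϖᵏe₀ ∈ M` (isotropic, `J₂`-exactly), a partner `y ∈ M` with `h(f₀, y) = 1` (unimodularity, ★ O'Meara 82:17),
the isotropic correction `f₂ = y − t·h(y,y)·f₀` (`t + σt = 1`, `|t| ≤ 1`: `t = 1∕2` at a tame place, the datum's trace element at an inert one); `u = (f₀ | f₂)` has Gram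
matrix EXACTLY `J₂`, `u·𝒪² ≤ M`, both unimodular ⇒ equal.  No condition on `σϖ`, no residue-field hypothesis.

* §1 `det_antidiagonal_two`, `v_det_antidiagonal_two`, `det_gram_two`, `isSelfDualLattice_stdLattice_two_of_v` (the root `𝒪²` is self-dual), `transpose_of_mulVec_single_two`.
* §2 **`exists_unitary_mapGL_stdLattice_eq_of_isSelfDualLattice_two_of_trace`** (head, any trace element), **`exists_unitary_mapGL_stdLattice_eq_of_isSelfDualLattice_two_of_v_two`**
  (`|2| = 1`, the `htrans` shape `M = u·L₀`), `forall_isSelfDualLattice_two_exists_mapGL_stdLattice_eq_of_v_two`.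

HONEST LABEL: HC_CM is proved only modulo the 2 remaining named inputs (hLiu418 24832, h413 24833) until rung 0 closes; elementary lattice algebra, no books consequence.
-/

set_option autoImplicit false

noncomputable section

open scoped Valued WithZero Matrix MatrixGroups

namespace Literature.NumberTheory.Automorphic.UnitaryLatticeTree

open Literature.NumberTheory.Automorphic Literature.NumberTheory.Automorphic.HermitianLattice
open Literature.NumberTheory.Automorphic.CartanUnique

variable {K : Type*} [Field K] [Valued K ℤᵐ⁰] {σ : K →+* K} {ϖ : K}

/-! ## §1 Rank-2 algebra of `J₂ = antidiag(1,1)` -/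

omit [Valued K ℤᵐ⁰] in
/-- The entries of `J₂`. [cite: Jacobowitz1962, §4] -/
theorem antidiagonal_two_over_apply (i j : Fin 2) : (StdForm.antidiagonal 2).over K i j = if j = Fin.rev i then (1 : K) else 0 := by
  simp only [StdForm.over, Matrix.map_apply, StdForm.antidiagonal_J_apply]
  split_ifs <;> simp

omit [Valued K ℤᵐ⁰] in
/-- `det J₂ = −1` on `K²`. [cite: Jacobowitz1962, §4] -/
theorem det_antidiagonal_two : ((StdForm.antidiagonal 2).over K).det = -1 := by
  rw [Matrix.det_fin_two]
  simp [antidiagonal_two_over_apply, Fin.rev]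

/-- `|det J₂| = 1`. [cite: Jacobowitz1962, §4] -/
theorem v_det_antidiagonal_two : Valued.v ((StdForm.antidiagonal 2).over K).det = 1 := by
  rw [det_antidiagonal_two, Valuation.map_neg, map_one]

omit [Valued K ℤᵐ⁰] in
/-- **Gram determinant at rank 2**: `det(ᵗσ(A) J₂ A) = −σ(det A)·det A`. [cite: Jacobowitz1962, §4] -/
theorem det_gram_two (A : Matrix (Fin 2) (Fin 2) K) : ((A.map σ)ᵀ * (StdForm.antidiagonal 2).over K * A).det = -(σ A.det * A.det) := by
  rw [Matrix.det_mul, Matrix.det_mul, Matrix.det_transpose, det_antidiagonal_two,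
    show (A.map σ).det = σ A.det by rw [RingHom.map_det, RingHom.mapMatrix_apply]]
  ring

/-- **THE ROOT `𝒪²` IS SELF-DUAL for `(σ, ϖ, J₂)`** (any `σ`, `ϖ` a uniformiser). [cite: Jacobowitz1962, §7] [cite: BruhatTits1972, §10] -/
theorem isSelfDualLattice_stdLattice_two_of_v (hϖ : Valued.v ϖ = WithZero.exp (-1 : ℤ)) :
    IsSelfDualLattice σ ϖ ((StdForm.antidiagonal 2).over K) (stdLattice K 2) :=
  isSelfDualLattice_stdLattice isIntMatrix_antidiagonal isIntMatrix_antidiagonal_inv v_det_antidiagonal_two (uniformizer_mem_integer hϖ)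

omit [Valued K ℤᵐ⁰] in
/-- The columns of the transpose of a row-stack: `(of v)ᵀ e_j = v j` (rank 2). [cite: Jacobowitz1962, §4] -/
theorem transpose_of_mulVec_single_two (v : Fin 2 → Fin 2 → K) (j : Fin 2) : ((Matrix.of v)ᵀ).mulVec (Pi.single j 1) = v j := by
  funext i; rw [Matrix.mulVec_single_one]; rfl

/-! ## §2 Every self-dual lattice of `(K², J₂)` is `u·𝒪²`, `u ∈ U(σ, J₂)` -/

set_option maxHeartbeats 800000 in
-- budget only: one `fin_cases`-driven Gram computation.
/-- **`U(σ, J₂)` IS TRANSITIVE ON THE SELF-DUAL LATTICES OF THE HYPERBOLIC PLANE — WITHOUT A DATUM.**  `σ` an involution preserving `v`, `ϖ` a uniformiser, `t + σt = 1` with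
`t ∈ 𝒪`.  Every self-dual `M` (for `J₂`, any scaling parameter `ϖ′`) is `u·𝒪²` with `u ∈ U(σ, J₂)`: primitive isotropic `f₀ = ϖᵏe₀ ∈ M`, partner `y` (`h(f₀,y) = 1`), isotropic
`f₂ = y − t·h(y,y)·f₀` with `h(f₀,f₂) = 1`; `u = (f₀ | f₂)` has Gram `J₂` and `u·𝒪² ≤ M`, both unimodular ⇒ equal. [cite: Jacobowitz1962, §7 Thm. 7.1, §8]
[cite: Omeara1963, §82F (82:17)] [cite: BruhatTits1972, §10] -/
theorem exists_unitary_mapGL_stdLattice_eq_of_isSelfDualLattice_two_of_trace (hσ : ∀ x, σ (σ x) = x) (hvσ : ∀ a, Valued.v (σ a) = Valued.v a)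
    (hϖ : Valued.v ϖ = WithZero.exp (-1 : ℤ)) (htrace : ∃ t : K, Valued.v t ≤ 1 ∧ t + σ t = 1)
    {ϖ' : K} {M : Submodule 𝒪[K] (Fin 2 → K)} (hM : IsSelfDualLattice σ ϖ' ((StdForm.antidiagonal 2).over K) M) :
    ∃ u : unitaryGroupOfForm σ ((StdForm.antidiagonal 2).over K), mapGL (u : GL (Fin 2) K) (stdLattice K 2) = M := by
  have hϖ1 : Valued.v ϖ ≤ 1 := by rw [hϖ, ← WithZero.exp_zero]; exact WithZero.exp_le_exp.2 (by norm_num)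
  obtain ⟨t, ht1, htt⟩ := htrace
  have herm : ∀ y z : Fin 2 → K, B₀ σ 2 z y = σ (B₀ σ 2 y z) := fun y z => (isHermitianForm_B₀ hσ y z).symm
  have hL : IsUnimodularLattice (B₀ σ 2) (frame K 2 Finset.univ) M := isUnimodularLattice_of_isSelfDualLattice hvσ hM
  obtain ⟨g, hMg, -, -, -⟩ := id hM
  -- §1: the primitive isotropic `f₀ = ϖᵏ e₀ ∈ M` and its partner
  obtain ⟨k, hf₀M, hprim⟩ := exists_zpow_smul_single_mem_primitive hϖ g 0
  rw [← hMg] at hf₀M hprim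
  set f₀ : Fin 2 → K := (ϖ ^ k) • (Pi.single 0 1 : Fin 2 → K) with hf₀
  have hf₀f₀ : B₀ σ 2 f₀ f₀ = 0 := by
    rw [hf₀, form_smul_left, form_smul_right, B₀_single_single, if_neg (by decide), mul_zero, mul_zero]
  obtain ⟨y, hyM, hf₀y⟩ := hL.exists_apply_eq_one_of_not_mem' hϖ hvσ (isHermitianForm_B₀ hσ) hf₀M hprim
  have hyf₀ : B₀ σ 2 y f₀ = 1 := by rw [herm, hf₀y, map_one]
  have hηv : Valued.v (B₀ σ 2 y y) ≤ 1 := hL.integral y hyM y hyM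
  have hση : σ (B₀ σ 2 y y) = B₀ σ 2 y y := (isHermitianForm_B₀ hσ).apply_self y
  -- the isotropic partner `f₂ = y + ν f₀`, `ν = −t·h(y,y)`
  set ν : K := -(t * B₀ σ 2 y y) with hν
  have hvν : Valued.v ν ≤ 1 := by rw [hν, Valuation.map_neg, map_mul]; exact mul_le_one' ht1 hηv
  have hσν : σ ν = -(σ t * B₀ σ 2 y y) := by rw [hν, map_neg, map_mul, hση]
  set f₂ : Fin 2 → K := y + ν • f₀ with hf₂
  have hf₂M : f₂ ∈ M := M.add_mem hyM (smul_mem_of_v_le _ hvν hf₀M)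
  have hf₀f₂ : B₀ σ 2 f₀ f₂ = 1 := by rw [hf₂, map_add, form_smul_right, hf₀y, hf₀f₀, mul_zero, add_zero]
  have hf₂f₀ : B₀ σ 2 f₂ f₀ = 1 := by rw [herm, hf₀f₂, map_one]
  have hf₂f₂ : B₀ σ 2 f₂ f₂ = 0 := by
    have h : B₀ σ 2 f₂ f₂ = B₀ σ 2 y y + ν + σ ν := by
      simp only [hf₂, map_add, LinearMap.add_apply, form_smul_left, form_smul_right, hyf₀, hf₀y, hf₀f₀]; ring
    rw [h, hσν, hν]
    linear_combination (-(B₀ σ 2 y y)) * htt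
  -- §2: the unitary matrix `u = (f₀ | f₂)`
  set U : Matrix (Fin 2) (Fin 2) K := (Matrix.of ![f₀, f₂])ᵀ with hU
  have hU0 : U.mulVec (Pi.single 0 1) = f₀ := transpose_of_mulVec_single_two _ 0
  have hU1 : U.mulVec (Pi.single 1 1) = f₂ := transpose_of_mulVec_single_two _ 1
  have hUJ : (U.map σ)ᵀ * (StdForm.antidiagonal 2).over K * U = (StdForm.antidiagonal 2).over K := by
    ext i j
    rw [← B₀_mulVec_single_eq_gram, antidiagonal_two_over_apply]
    fin_cases i <;> fin_cases j <;>
      simp only [Fin.zero_eta, Fin.mk_one, hU0, hU1, hf₀f₀, hf₀f₂, hf₂f₀, hf₂f₂] <;> rfl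
  have hdetU : U.det ≠ 0 := by
    intro h
    have h2 := congrArg Matrix.det hUJ
    rw [det_gram_two, h, mul_zero, neg_zero, det_antidiagonal_two] at h2
    norm_num at h2
  set u : GL (Fin 2) K := Matrix.GeneralLinearGroup.mkOfDetNeZero U hdetU with hu
  have huval : (u : Matrix (Fin 2) (Fin 2) K) = U := rfl
  have huU : u ∈ unitaryGroupOfForm σ ((StdForm.antidiagonal 2).over K) := by rw [mem_unitaryGroupOfForm_iff, huval]; exact hUJ
  refine ⟨⟨u, huU⟩, ?_⟩
  change mapGL u (stdLattice K 2) = M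
  have hlatt : mapGL u (stdLattice K 2) = latt U := by rw [← latt_one, mapGL_latt_eq, huval, Matrix.mul_one]
  -- `u·𝒪² ≤ M`
  have hle : mapGL u (stdLattice K 2) ≤ M := by
    rw [hlatt, latt_le_iff_forall_mulVec_single_mem]
    intro j
    fin_cases j
    · simp only [Fin.zero_eta]; rw [hU0]; exact hf₀M
    · simp only [Fin.mk_one]; rw [hU1]; exact hf₂M
  -- both unimodular ⇒ equal
  have h0 : IsSelfDualLattice σ ϖ ((StdForm.antidiagonal 2).over K) (mapGL u (stdLattice K 2)) :=
    isVertexLattice_mapGL σ ϖ _ u huU (isSelfDualLattice_stdLattice_two_of_v hϖ)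
  exact IsUnimodularLattice.eq_of_le hL (isUnimodularLattice_of_isSelfDualLattice hvσ h0) hle

/-- **RANK-2 SELF-DUAL TRANSITIVITY AT `|2| = 1`** (trace element `t = 1∕2`; tame ramified and non-dyadic inert places alike), in the `htrans` shape of ★
`ncard_fixedBy_quotient_sep_eq_ncard_selfDual_fixed_sep`: every self-dual `L` of `(K², J₂)` is `L = u·𝒪²`, `u ∈ U(σ, J₂)`. [cite: Jacobowitz1962, §8] [cite: BruhatTits1972, §10] -/
theorem exists_unitary_mapGL_stdLattice_eq_of_isSelfDualLattice_two_of_v_two (hσ : ∀ x, σ (σ x) = x) (hvσ : ∀ a, Valued.v (σ a) = Valued.v a)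
    (hϖ : Valued.v ϖ = WithZero.exp (-1 : ℤ)) (h2 : Valued.v (2 : K) = 1)
    {L : Submodule 𝒪[K] (Fin 2 → K)} (hL : IsSelfDualLattice σ ϖ ((StdForm.antidiagonal 2).over K) L) :
    ∃ u : unitaryGroupOfForm σ ((StdForm.antidiagonal 2).over K), L = mapGL (u : GL (Fin 2) K) (stdLattice K 2) := by
  have h20 : (2 : K) ≠ 0 := fun h => by rw [h, map_zero] at h2; exact zero_ne_one h2
  obtain ⟨u, hu⟩ := exists_unitary_mapGL_stdLattice_eq_of_isSelfDualLattice_two_of_trace hσ hvσ hϖ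
    ⟨1 / 2, by rw [map_div₀, map_one, h2, div_one], by rw [map_div₀, map_one, map_ofNat, ← add_div, one_add_one_eq_two, div_self h20]⟩ hL
  exact ⟨u, hu.symm⟩

/-- The same, quantified over all self-dual `M` (any scaling parameter `ϖ′`). [cite: Jacobowitz1962, §8] [cite: BruhatTits1972, §10] -/
theorem forall_isSelfDualLattice_two_exists_mapGL_stdLattice_eq_of_v_two (hσ : ∀ x, σ (σ x) = x) (hvσ : ∀ a, Valued.v (σ a) = Valued.v a)
    (hϖ : Valued.v ϖ = WithZero.exp (-1 : ℤ)) (h2 : Valued.v (2 : K) = 1) {ϖ' : K} :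
    ∀ M : Submodule 𝒪[K] (Fin 2 → K), IsSelfDualLattice σ ϖ' ((StdForm.antidiagonal 2).over K) M →
      ∃ u : unitaryGroupOfForm σ ((StdForm.antidiagonal 2).over K), mapGL (u : GL (Fin 2) K) (stdLattice K 2) = M := by
  have h20 : (2 : K) ≠ 0 := fun h => by rw [h, map_zero] at h2; exact zero_ne_one h2
  intro M hM
  exact exists_unitary_mapGL_stdLattice_eq_of_isSelfDualLattice_two_of_trace hσ hvσ hϖ
    ⟨1 / 2, by rw [map_div₀, map_one, h2, div_one], by rw [map_div₀, map_one, map_ofNat, ← add_div, one_add_one_eq_two, div_self h20]⟩ hM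

end Literature.NumberTheory.Automorphic.UnitaryLatticeTree

end
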